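import Summits.Ventures.DiscreteObjects.Hadamard.Frobenius83Row

/-!
# Hadamard 668 census, family F12 — the Frobenius classes `Z_37 ⋊ Z_18` and `Z_37 ⋊ Z_36` in the kernel

Framing: lottery ticket; floor = certified bounds/negative ranges.

Cell pub-namedobj (venture DiscreteObjects), target (H), hadamard gen 4, family F12 (FAMILY-F12.md): the symmetric
2-(667,333,166) design (⇔ a Hadamard matrix of order 668) with a Frobenius automorphism group `Z_p ⋊ U`, all orbits of
length 1 or `p`, minimal fixed structure.  For `p = 37` (`667 = 18·37 + 1`) and `U ⊇` the squares `⟨4⟩ ≤ (ℤ/37)ˣ`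
(order 18), the paper reduction (FAMILY-F12 §2) turns one point-orbit row of the incidence matrix into 18 `0/1` functions
`x_j : ZMod 37 → {0,1}`, each invariant under `i ↦ 4 i`, with `Σ_j |x_j| = 333 - σ` and `Σ_j PAF_(x_j)(s) = 166 - σ` for every
`s ≠ 0`, `0 ≤ σ ≤ 1` the number of fixed blocks through the orbit.  This file is the kernel certificate that the system has
NO solution (`no_frobenius37_row`; the shifts `s = 1` (a square) and `s = 2` (a non-square) suffice): a `4`-invariant
function on `ZMod 37` is a three-valued block (`eq_blk37`; `37 ≡ 1 (mod 4)`, so the non-squares are `2·4^k`; tables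
`dlog37`/`qrMask37` checked by `decide`), its profile `(|x|, PAF(1) + PAF(2))` makes `u = |x| - PAF(1) - PAF(2)` one of
`0, 1, 1, 0, -34, -37` (`blk37_facts`, by `decide`), `Σ u = 1 + σ` excludes the large blocks, then every weight is
`≤ 19`, hence `≥ 9`, hence `|x| + u = 19` for every block and `Σ (|x| + u) = 342 ≠ 334`.  The hand version is the
counting lemma of FAMILY-F12 §3; two further implementations agree (§4).  Ours, not literature; no `sorry`, no `native_decide`.
-/

open Finset BigOperators

namespace Summit.Ventures.DiscreteObjects.Hadamard

open Literature.Combinatorics.Designs.LegendrePairs (PAF)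

/-! ## §1 The orbit of the multiplier `4` on `ZMod 37` (tables, kernel-checked) -/

/-- walk along the orbit of `1` under the multiplier `4`: `orb37 k = 4^k` in `ZMod 37` -/
def orb37 : ℕ → ZMod 37
  | 0 => 1
  | k + 1 => 4 * orb37 k

/-- discrete-logarithm table for `ZMod 37`: for `i ≠ 0`, `orb37 (dlog37[i]) = i` if `i` is a square and `2 · orb37 (dlog37[i]) = i`
otherwise (`2` is a non-square mod 37) -/
def dlog37 : List ℕ :=
  [0, 0, 0, 13, 1, 11, 13, 16, 1, 8, 12, 15, 14, 5, 16, 6, 2, 3, 8, 17, 12, 11, 15, 7, 14, 5, 6, 3, 17, 10, 7, 4, 2, 10, 4, 9, 9]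

/-- bit mask of the 18 non-zero squares modulo 37 -/
def qrMask37 : ℕ := 96068509338

/-- `i` is a non-zero quadratic residue mod 37 (table lookup) -/
def isQR37 (i : ZMod 37) : Bool := Nat.testBit qrMask37 i.val

set_option maxRecDepth 100000 in
set_option maxHeartbeats 4000000 in
/-- kernel check of both tables -/
theorem orbit_cover37 : ∀ i : ZMod 37,
    i = 0 ∨ (isQR37 i = true ∧ orb37 (dlog37.getD i.val 0) = i) ∨
      (isQR37 i = false ∧ 2 * orb37 (dlog37.getD i.val 0) = i) := by
  decide

/-- invariance under `i ↦ 4 i` propagates along the orbit walk, from `1` and from `2` -/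
lemma apply_orb37 {α : Type*} (x : ZMod 37 → α) (hinv : ∀ i, x (4 * i) = x i) (k : ℕ) :
    x (orb37 k) = x 1 ∧ x (2 * orb37 k) = x 2 := by
  induction k with
  | zero => simp [orb37]
  | succ k ih =>
    refine ⟨?_, ?_⟩
    · show x (4 * orb37 k) = x 1
      rw [hinv]; exact ih.1
    · show x (2 * (4 * orb37 k)) = x 2
      rw [mul_left_comm, hinv]; exact ih.2

/-- the three-valued block on `ZMod 37`: `e0` at `0`, `e1` on the non-zero squares, `e2` on the non-squares -/
def blk37 {α : Type*} (e0 e1 e2 : α) (i : ZMod 37) : α :=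
  if i = 0 then e0 else if isQR37 i = true then e1 else e2

/-- a `4`-invariant function on `ZMod 37` is the block of its values at `0`, `1` and `2` -/
theorem eq_blk37 {α : Type*} (x : ZMod 37 → α) (hinv : ∀ i, x (4 * i) = x i) :
    x = blk37 (x 0) (x 1) (x 2) := by
  funext i
  by_cases hi : i = 0
  · subst hi; simp [blk37]
  · rcases orbit_cover37 i with h0 | ⟨hq, he⟩ | ⟨hq, he⟩
    · exact absurd h0 hi
    · have h := (apply_orb37 x hinv (dlog37.getD i.val 0)).1
      rw [he] at h
      unfold blk37; rw [if_neg hi, if_pos hq]; exact h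
    · have h := (apply_orb37 x hinv (dlog37.getD i.val 0)).2
      rw [he] at h
      have hq' : ¬ (isQR37 i = true) := by rw [hq]; exact Bool.false_ne_true
      unfold blk37; rw [if_neg hi, if_neg hq']; exact h

/-! ## §2 The profiles of the eight `0/1` blocks (kernel-checked) -/

set_option maxRecDepth 100000 in
set_option maxHeartbeats 4000000 in
/-- for a `0/1` block `x` with `W = PAF_x(0) = |x|` and `u = W - PAF_x(1) - PAF_x(2)`: `u ≤ 1`; `u ≥ 0` or `u ≤ -34`;
`u ≥ 0 ⇒ W ≤ 19`; `u ≥ 0 ⇒ W ≥ 9 ⇒ W + u = 19` -/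
theorem blk37_facts : ∀ e0 ∈ [(0 : ℤ), 1], ∀ e1 ∈ [(0 : ℤ), 1], ∀ e2 ∈ [(0 : ℤ), 1],
    PAF (blk37 e0 e1 e2) 0 - PAF (blk37 e0 e1 e2) 1 - PAF (blk37 e0 e1 e2) 2 ≤ 1 ∧
    (0 ≤ PAF (blk37 e0 e1 e2) 0 - PAF (blk37 e0 e1 e2) 1 - PAF (blk37 e0 e1 e2) 2 ∨
      PAF (blk37 e0 e1 e2) 0 - PAF (blk37 e0 e1 e2) 1 - PAF (blk37 e0 e1 e2) 2 ≤ -34) ∧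
    (0 ≤ PAF (blk37 e0 e1 e2) 0 - PAF (blk37 e0 e1 e2) 1 - PAF (blk37 e0 e1 e2) 2 → PAF (blk37 e0 e1 e2) 0 ≤ 19) ∧
    (0 ≤ PAF (blk37 e0 e1 e2) 0 - PAF (blk37 e0 e1 e2) 1 - PAF (blk37 e0 e1 e2) 2 → 9 ≤ PAF (blk37 e0 e1 e2) 0 →
      PAF (blk37 e0 e1 e2) 0 + (PAF (blk37 e0 e1 e2) 0 - PAF (blk37 e0 e1 e2) 1 - PAF (blk37 e0 e1 e2) 2) = 19) := by
  decide

/-- for a `0/1` function, `PAF_x(0) = Σ_i x_i = |x|` -/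
lemma paf_zero_01_37 (x : ZMod 37 → ℤ) (h01 : ∀ i, x i = 0 ∨ x i = 1) : PAF x 0 = ∑ i, x i := by
  unfold PAF
  refine Finset.sum_congr rfl fun i _ => ?_
  rw [add_zero]
  rcases h01 i with h | h <;> rw [h] <;> norm_num

/-! ## §3 The row system has no solution -/

/-- **Family F12, classes `Z_37 ⋊ Z_18` and `Z_37 ⋊ Z_36` (kernel certificate of the row system).**  There are no 18
`0/1` functions on `ZMod 37`, invariant under the squares `⟨4⟩`, with `Σ_j |x_j| = 333 - σ` and
`Σ_j PAF_(x_j)(1) = Σ_j PAF_(x_j)(2) = 166 - σ` for some `0 ≤ σ ≤ 1`.  (Invariance under all of `(ℤ/37)ˣ` is a sub-case.) -/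
theorem no_frobenius37_row (x : Fin 18 → ZMod 37 → ℤ) (h01 : ∀ j i, x j i = 0 ∨ x j i = 1)
    (hinv : ∀ j i, x j (4 * i) = x j i) (σ : ℤ) (hσ : 0 ≤ σ) (hσ' : σ ≤ 1)
    (hw : ∑ j, ∑ i, x j i = 333 - σ) (hP1 : ∑ j, PAF (x j) 1 = 166 - σ) (hP2 : ∑ j, PAF (x j) 2 = 166 - σ) : False := by
  -- per-block facts
  have hb : ∀ j, PAF (x j) 0 - PAF (x j) 1 - PAF (x j) 2 ≤ 1 ∧
      (0 ≤ PAF (x j) 0 - PAF (x j) 1 - PAF (x j) 2 ∨ PAF (x j) 0 - PAF (x j) 1 - PAF (x j) 2 ≤ -34) ∧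
      (0 ≤ PAF (x j) 0 - PAF (x j) 1 - PAF (x j) 2 → PAF (x j) 0 ≤ 19) ∧
      (0 ≤ PAF (x j) 0 - PAF (x j) 1 - PAF (x j) 2 → 9 ≤ PAF (x j) 0 →
        PAF (x j) 0 + (PAF (x j) 0 - PAF (x j) 1 - PAF (x j) 2) = 19) := by
    intro j
    have := blk37_facts (x j 0) (mem_01 (h01 j 0)) (x j 1) (mem_01 (h01 j 1)) (x j 2) (mem_01 (h01 j 2))
    rw [← eq_blk37 (x j) (hinv j)] at this
    exact this
  have hw' : ∑ j, PAF (x j) 0 = 333 - σ := by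
    rw [Finset.sum_congr rfl (fun j _ => paf_zero_01_37 (x j) (h01 j))]; exact hw
  -- Σ u = 1 + σ
  have hu : ∑ j, (PAF (x j) 0 - PAF (x j) 1 - PAF (x j) 2) = 1 + σ := by
    rw [Finset.sum_sub_distrib, Finset.sum_sub_distrib]; linarith
  -- step 1: no block is large
  have hsmall : ∀ j, 0 ≤ PAF (x j) 0 - PAF (x j) 1 - PAF (x j) 2 := by
    intro j
    rcases (hb j).2.1 with h | h
    · exact h
    · exfalso
      have hsplit := Finset.add_sum_erase Finset.univ (fun i => PAF (x i) 0 - PAF (x i) 1 - PAF (x i) 2) (Finset.mem_univ j)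
      have hrest : ∑ i ∈ Finset.univ.erase j, (PAF (x i) 0 - PAF (x i) 1 - PAF (x i) 2) ≤ 17 := by
        have := Finset.sum_le_sum (s := Finset.univ.erase j) (fun i _ => (hb i).1)
        have hcard : (Finset.univ.erase j).card = 17 := by
          rw [Finset.card_erase_of_mem (Finset.mem_univ j)]; simp
        rw [Finset.sum_const, hcard] at this
        simpa using this
      linarith
  -- step 2: every weight ≤ 19
  have hle : ∀ j, PAF (x j) 0 ≤ 19 := fun j => (hb j).2.2.1 (hsmall j)
  -- step 3: every weight ≥ 9
  have hge : ∀ j, 9 ≤ PAF (x j) 0 := by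
    intro j
    have hsplit := Finset.add_sum_erase Finset.univ (fun i => PAF (x i) 0) (Finset.mem_univ j)
    have hrest : ∑ i ∈ Finset.univ.erase j, PAF (x i) 0 ≤ 17 * 19 := by
      have := Finset.sum_le_sum (s := Finset.univ.erase j) (fun i _ => hle i)
      have hcard : (Finset.univ.erase j).card = 17 := by
        rw [Finset.card_erase_of_mem (Finset.mem_univ j)]; simp
      rw [Finset.sum_const, hcard] at this
      simpa using this
    linarith
  -- step 4: every block has W + u = 19, so Σ (W + u) = 342; but it is 334
  have heq : ∀ j, PAF (x j) 0 + (PAF (x j) 0 - PAF (x j) 1 - PAF (x j) 2) = 19 := fun j => (hb j).2.2.2 (hsmall j) (hge j)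
  have hsum : ∑ j, (PAF (x j) 0 + (PAF (x j) 0 - PAF (x j) 1 - PAF (x j) 2)) = 342 := by
    rw [Finset.sum_congr rfl (fun j _ => heq j)]; simp
  rw [Finset.sum_add_distrib, hw', hu] at hsum
  linarith

end Summit.Ventures.DiscreteObjects.Hadamard
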